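import Literature.NumberTheory.Transcendental.KZSemiCanonicalReductionProofs
import Literature.NumberTheory.Transcendental.KZLogCalculusProofs

/-!
# Route StandardParts — `SpArcLifting` (stmt-KontsevichZagierPeriods-3155): zero-sum rational step
functions are relations of the Kontsevich–Zagier calculus

Problem `KontsevichZagierPeriods`, route `StandardParts`, crux item stmt-KontsevichZagierPeriods-3155
(`SpArcLifting`), line `registered`, lead c2. Helper file (`--supports`); the move-theoretic half of
"KZ classes are `L¹`-dense in their value slice" (`StandardPartsSpArcLiftingDensity.lean`).

Main statement `of_mem_relations_of_step`: if an integral representation `Z` on the whole space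
`ℝⁿ` has integrand the rational step function `∑_{K < Lⁿ} q_K · 𝟙_{C_K} (x + R)` on an integer
translate of the dyadic grid of level `j` (`C_K = hoCube j (digits n L K)`,
`Literature/NumberTheory/Transcendental/SemialgebraicVolume.lean`) and the coefficients have ZERO SUM,
then `[Z] ∈ KZ.relations`. The chain of moves (rules 1) and 2) of [Kontsevich–Zagier 2001, §1.2]
only): integrand additivity on `ℝⁿ` splits `Z` into the terms `q_K · 𝟙_{C_K − R}` (overlaps are
irrelevant); extension by zero is domain additivity plus a zero representation; each cube is a
rational TRANSLATE of the cube of code `0` (`KZ.exists_translate`, rule 2) with Jacobian `1`); on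
that common cube, integrand additivity sums the constants `q_K` to `∑ q_K = 0`, a zero
representation, which is a relation. No subdivision and no disjointness is used.

Also here: `of_sub_of_mem_relations_of_indicator` (extension by zero is a relation) and
`isSemialgebraicFunOn_indicator_const` (bookkeeping).

Sources: M. Kontsevich, D. Zagier, *Periods* (2001), §1.2 rules 1), 2) [KontsevichZagier2001];
J. Viu-Sos, *A semi-canonical reduction for periods of Kontsevich–Zagier*, Int. J. Number Theory 17
(2021), Lemma 4.3 (translations of grid cubes are moves) [ViuSos2021].
-/

noncomputable section

namespace Summit.KontsevichZagierPeriods.StandardParts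

open MeasureTheory Set
open Literature.NumberTheory.Transcendental
open Literature.NumberTheory.Transcendental.KZ
open Literature.ModelTheory.ExponentialFields (IsSemialgebraic isSemialgebraic_univ)

variable {n : ℕ}

/-! ### Extension by zero -/

/-- **Extension by zero is a relation.** If `R` carries, on its domain, the extension by zero of
the integrand of `r` from the subdomain `r.domain ⊆ R.domain`, then `[R] − [r] ∈ relations`: split
`R` along `r.domain` (rule 1a); the first piece is congruent to `r`, the second has integrand `0`.
[cite: KontsevichZagier2001, §1.2 rule (1)] -/
theorem of_sub_of_mem_relations_of_indicator (R r : IntegralRep n) (hsub : r.domain ⊆ R.domain)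
    (hR : EqOn R.integrand (r.domain.indicator r.integrand) R.domain) :
    of R - of r ∈ relations := by
  have hA : IsSemialgebraic ℚ r.domain := r.isSemialgebraic_domain
  have hD : IsSemialgebraic ℚ (R.domain \ r.domain) := R.isSemialgebraic_domain.diff hA
  have hDsub : R.domain \ r.domain ⊆ R.domain := fun _ hx => hx.1
  set r₁ := R.restrict r.domain hA hsub with hr₁
  set r₂ := R.restrict (R.domain \ r.domain) hD hDsub with hr₂
  have hsplit : of R - of r₁ - of r₂ ∈ relations := by
    refine domainAddRel_subset_relations ⟨n, R, r₁, r₂, ?_, ?_, fun _ _ => rfl, fun _ _ => rfl, rfl⟩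
    · simp only [hr₁, hr₂, IntegralRep.domain_restrict, Set.union_sdiff_cancel hsub]
    · rw [show r₁.domain ∩ r₂.domain = ∅ from
        eq_empty_of_forall_notMem fun x hx => hx.2.2 hx.1, measure_empty]
  have h₁ : of r₁ - of r ∈ relations := by
    refine of_sub_of_mem_relations_of_eqOn (by simp [hr₁]) fun x hx => ?_
    have hx' : x ∈ r.domain := by simpa [hr₁] using hx
    show R.integrand x = r.integrand x
    rw [hR (hsub hx'), indicator_of_mem hx']
  have h₂ : of r₂ ∈ relations := by
    refine of_mem_relations_of_eqOn_zero r₂ fun x hx => ?_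
    have hx' : x ∈ R.domain \ r.domain := by simpa [hr₂] using hx
    show R.integrand x = 0
    rw [hR hx'.1, indicator_of_notMem hx'.2]
  have : of R - of r = (of R - of r₁ - of r₂) + (of r₁ - of r) + of r₂ := by abel
  rw [this]
  exact relations.add_mem (relations.add_mem hsplit h₁) h₂

/-- The extension by zero of a rational constant off a `ℚ`-semialgebraic set is `ℚ`-semialgebraic
on every `ℚ`-semialgebraic set. [cite: BochnakCosteRoy1998, §2.2] -/
theorem isSemialgebraicFunOn_indicator_const {s A : Set (Fin n → ℝ)} (hs : IsSemialgebraic ℚ s)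
    (hA : IsSemialgebraic ℚ A) (q : ℚ) :
    IsSemialgebraicFunOn ℚ s (A.indicator fun _ => (q : ℝ)) := by
  have h1 : IsSemialgebraicFunOn ℚ (s ∩ A) (fun _ => (q : ℝ)) := isSemialgebraicFunOn_ratCast (hs.inter hA) q
  have h2 : IsSemialgebraicFunOn ℚ (s \ A) (fun _ => ((0 : ℚ) : ℝ)) :=
    isSemialgebraicFunOn_ratCast (hs.diff hA) 0
  have h := h1.union h2 (F := A.indicator fun _ => (q : ℝ)) (fun x hx => indicator_of_mem hx.2 _)
    (fun x hx => by rw [indicator_of_notMem hx.2]; push_cast; rfl)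
  rwa [Set.inter_union_sdiff] at h

/-! ### Translated grid cubes -/

/-- The integer translate `{x | x + R ∈ C}` of a `ℚ`-semialgebraic set is `ℚ`-semialgebraic
(preimage under the polynomial map `x ↦ x + R`). [cite: BochnakCosteRoy1998, §2.2] -/
theorem isSemialgebraic_setOf_add_mem {C : Set (Fin n → ℝ)} (hC : IsSemialgebraic ℚ C) (R : ℕ) :
    IsSemialgebraic ℚ {x : Fin n → ℝ | x + (fun _ => (R : ℝ)) ∈ C} := by
  have h := hC.preimage_aeval (fun i : Fin n => (MvPolynomial.X i + MvPolynomial.C (R : ℚ) :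
    MvPolynomial (Fin n) ℚ))
  convert h using 1
  ext x
  simp only [mem_setOf_eq, mem_preimage]
  congr! 1
  ext i
  simp

/-- Rewriting a scaled translated indicator as the indicator of the translate:
`a · 𝟙_C (x + c) = 𝟙_{{y | y + c ∈ C}} (a) x`. [folklore] -/
theorem const_mul_indicator_add_eq (C : Set (Fin n → ℝ)) (a : ℝ) (c x : Fin n → ℝ) :
    a * C.indicator 1 (x + c) = {y : Fin n → ℝ | y + c ∈ C}.indicator (fun _ => a) x := by
  by_cases hx : x + c ∈ C
  · rw [indicator_of_mem hx, indicator_of_mem (show x ∈ {y : Fin n → ℝ | y + c ∈ C} from hx),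
      Pi.one_apply, mul_one]
  · rw [indicator_of_notMem hx, indicator_of_notMem (show x ∉ {y : Fin n → ℝ | y + c ∈ C} from hx),
      mul_zero]

/-- A rational step function on an integer translate of a dyadic grid is `ℚ`-semialgebraic on
`ℝⁿ` (finite sum of rational constants extended by zero off translated cubes).
[cite: BochnakCosteRoy1998, §2.2] -/
theorem isSemialgebraicFunOn_step (j L R : ℕ) (q : ℕ → ℚ) :
    IsSemialgebraicFunOn ℚ univ (fun x : Fin n → ℝ => ∑ K ∈ Finset.range (L ^ n),
      (q K : ℝ) * (hoCube j (digits n L K)).indicator 1 (x + fun _ => (R : ℝ))) :=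
  isSemialgebraicFunOn_finset_sum _ isSemialgebraic_univ fun K _ =>
    (isSemialgebraicFunOn_indicator_const isSemialgebraic_univ
      (isSemialgebraic_setOf_add_mem (isSemialgebraic_hoCube j (digits n L K)) R) (q K)).congr
      fun x _ => (const_mul_indicator_add_eq _ _ _ x).symm

/-- The extended-by-zero integrand `𝟙_σ · f` of an integral representation is `ℚ`-semialgebraic
on `ℝⁿ` (glue `f` on `σ` with `0` on `σᶜ`). [cite: BochnakCosteRoy1998, §2.2] -/
theorem isSemialgebraicFunOn_indicator_integrand (r : IntegralRep n) :
    IsSemialgebraicFunOn ℚ univ (r.domain.indicator r.integrand) := by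
  have h0 : IsSemialgebraicFunOn ℚ r.domainᶜ (fun _ => ((0 : ℚ) : ℝ)) :=
    isSemialgebraicFunOn_ratCast r.isSemialgebraic_domain.compl 0
  have h := r.isSemialgebraicFunOn_integrand.union h0 (F := r.domain.indicator r.integrand)
    (fun x hx => indicator_of_mem hx _)
    (fun x hx => by rw [indicator_of_notMem (fun h => hx h)]; push_cast; rfl)
  rwa [union_compl_self] at h

/-! ### Zero-sum rational step functions are relations -/

/-- **Zero-sum rational step functions on a translated dyadic grid are relations.** Let
`L R : ℕ`, `q : ℕ → ℚ` with `∑_{K < Lⁿ} q_K = 0`, and let `Z` be an integral representation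
with domain `ℝⁿ` and integrand `x ↦ ∑_{K < Lⁿ} q_K · 𝟙_{hoCube j (digits n L K)} (x + R)`. Then
`[Z] ∈ KZ.relations`. Moves used: integrand additivity on `ℝⁿ` (split into the `Lⁿ` terms),
extension by zero (`of_sub_of_mem_relations_of_indicator`), translation of each cube onto the cube of
code `0` (`KZ.exists_translate`, rule 2) with Jacobian `1`), and integrand additivity on that cube
summing the constants to `0`. [cite: KontsevichZagier2001, §1.2 rules (1), (2)]
[cite: ViuSos2021, Lemma 4.3] -/
theorem of_mem_relations_of_step {j L R : ℕ} (q : ℕ → ℚ)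
    (hq : ∑ K ∈ Finset.range (L ^ n), q K = 0) (Z : IntegralRep n) (hZd : Z.domain = univ)
    (hZi : ∀ x, Z.integrand x = ∑ K ∈ Finset.range (L ^ n),
      (q K : ℝ) * (hoCube j (digits n L K)).indicator 1 (x + fun _ => (R : ℝ))) :
    of Z ∈ relations := by
  classical
  set c : Fin n → ℝ := fun _ => (R : ℝ) with hc
  set N : ℕ := L ^ n with hN
  -- the reference cube `A₀ = {x | x + R ∈ hoCube j 0}` and the constant representations on it
  set k₀ : Fin n → ℕ := digits n L 0 with hk₀
  set A₀ : Set (Fin n → ℝ) := {x | x + c ∈ hoCube j k₀} with hA₀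
  have hA₀s : IsSemialgebraic ℚ A₀ := isSemialgebraic_setOf_add_mem (isSemialgebraic_hoCube j k₀) R
  have hA₀m : MeasurableSet A₀ := IsSemialgebraic.measurableSet_holds hA₀s
  have hA₀vol : volume A₀ ≠ ⊤ := by
    have : A₀ = (fun x => x + c) ⁻¹' hoCube j k₀ := rfl
    rw [this, ← Measure.map_apply (measurable_add_const c) (measurableSet_hoCube j k₀),
      (measurePreserving_add_right volume c).map_eq, volume_hoCube]
    exact ENNReal.ofReal_ne_top
  have hconst : ∀ a : ℚ, ∃ E : IntegralRep n, E.domain = A₀ ∧ E.integrand = fun _ => (a : ℝ) :=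
    fun a => ⟨⟨A₀, fun _ => (a : ℝ), hA₀s, isSemialgebraicFunOn_ratCast hA₀s a,
      integrableOn_const hA₀vol⟩, rfl, rfl⟩
  choose E hEd hEi using fun i : Fin N => hconst (q i)
  -- translate `E i` onto the cube of code `i`
  set v : Fin N → Fin n → ℚ := fun i l => ((digits n L i l : ℚ) - k₀ l) / 2 ^ j with hv
  have hv' : ∀ i, (fun l => (v i l : ℝ)) = cubeLo j (digits n L i) - cubeLo j k₀ := fun i =>
    ratCast_cubeShift j k₀ (digits n L i)
  choose B hBd hBi hBrel using fun i : Fin N => exists_translate (E i) (v i)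
  have hBmem : ∀ i x, x ∈ (B i).domain ↔ x + c ∈ hoCube j (digits n L i) := fun i x => by
    rw [hBd i, hv' i, mem_preimage, hEd i, hA₀, mem_setOf_eq, sub_add_eq_add_sub]
    exact sub_mem_hoCube_iff
  have hBint : ∀ i x, (B i).integrand x = (q i : ℝ) := fun i x => by
    rw [hBi i, hEi i]
  -- the terms `P i = [ℝⁿ, q_i · 𝟙_{C_i}(· + R)]`
  have hPfun : ∀ i : Fin N, ∀ x, (q (i : ℕ) : ℝ) * (hoCube j (digits n L i)).indicator 1 (x + c) =
      (B i).domain.indicator (fun _ => (q (i : ℕ) : ℝ)) x := fun i x => by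
    by_cases hx : x + c ∈ hoCube j (digits n L i)
    · rw [indicator_of_mem hx, indicator_of_mem ((hBmem i x).2 hx), Pi.one_apply, mul_one]
    · rw [indicator_of_notMem hx, indicator_of_notMem (fun h => hx ((hBmem i x).1 h)), mul_zero]
  have hPex : ∀ i : Fin N, ∃ P : IntegralRep n, P.domain = univ ∧
      P.integrand = fun x => (q (i : ℕ) : ℝ) * (hoCube j (digits n L i)).indicator 1 (x + c) := by
    intro i
    have hsa : IsSemialgebraicFunOn ℚ univ
        (fun x => (q (i : ℕ) : ℝ) * (hoCube j (digits n L i)).indicator 1 (x + c)) :=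
      (isSemialgebraicFunOn_indicator_const isSemialgebraic_univ (B i).isSemialgebraic_domain
        (q i)).congr fun x _ => (hPfun i x).symm
    have hint : IntegrableOn
        (fun x => (q (i : ℕ) : ℝ) * (hoCube j (digits n L i)).indicator 1 (x + c)) univ := by
      rw [integrableOn_univ, show (fun x => (q (i : ℕ) : ℝ) *
        (hoCube j (digits n L i)).indicator 1 (x + c)) =
          (B i).domain.indicator (fun _ => (q (i : ℕ) : ℝ)) from funext (hPfun i),
        integrable_indicator_iff (IntegralRep.measurableSet_domain_holds (B i))]
      have h := (B i).integrableOn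
      rw [hBi i, hEi i] at h
      exact h
    exact ⟨⟨univ, _, isSemialgebraic_univ, hsa, hint⟩, rfl, rfl⟩
  choose P hPd hPi using hPex
  -- (1) `[Z] ≡ ∑ [P i]` by integrand additivity on `ℝⁿ`
  obtain ⟨Z₀, hZ₀d, hZ₀i⟩ := exists_zeroRep (isSemialgebraic_univ (k := ℚ) (ι := Fin n) (R := ℝ))
  have e1 : of Z - of Z₀ - ∑ i : Fin N, of (P i) ∈ relations := by
    refine of_sub_of_sub_sum_mem_relations N Z Z₀ P (by rw [hZ₀d, hZd]) (fun i => by rw [hPd, hZd])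
      fun x _ => ?_
    show Z.integrand x = Z₀.integrand x + ∑ i : Fin N, (P i).integrand x
    rw [hZi x, hZ₀i, Pi.zero_apply, zero_add, Finset.sum_range]
    exact Finset.sum_congr rfl fun i _ => by rw [hPi]
  have e1' : of Z₀ ∈ relations := of_mem_relations_of_eqOn_zero Z₀ fun x _ => by rw [hZ₀i]
  -- (2) `[P i] ≡ [B i]` by extension by zero
  have e2 : ∑ i : Fin N, of (P i) - ∑ i : Fin N, of (B i) ∈ relations := by
    refine sum_sub_sum_mem_relations _ _ _ fun i _ => ?_
    refine of_sub_of_mem_relations_of_indicator (P i) (B i) (by rw [hPd]; exact subset_univ _)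
      fun x _ => ?_
    rw [hPi]
    show (q (i : ℕ) : ℝ) * (hoCube j (digits n L i)).indicator 1 (x + c) =
      (B i).domain.indicator (B i).integrand x
    rw [hPfun i x]
    congr 1
    funext y
    exact (hBint i y).symm
  -- (3) `[E i] ≡ [B i]` by translation (rule 2)
  have e3 : ∑ i : Fin N, of (E i) - ∑ i : Fin N, of (B i) ∈ relations :=
    sum_sub_sum_mem_relations _ _ _ fun i _ => changeOfVariablesRel_subset_relations (hBrel i)
  -- (4) `∑ [E i] ≡ 0` by integrand additivity on the reference cube and `∑ q = 0`
  obtain ⟨W₀, hW₀d, hW₀i⟩ := exists_zeroRep hA₀s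
  have hWex : ∃ W : IntegralRep n, W.domain = A₀ ∧
      W.integrand = fun x => W₀.integrand x + ∑ i : Fin N, (E i).integrand x := by
    have hfun : ∀ x, W₀.integrand x + ∑ i : Fin N, (E i).integrand x = ((0 : ℚ) : ℝ) := fun x => by
      rw [hW₀i, Pi.zero_apply, zero_add]
      simp_rw [hEi]
      have : ∑ i : Fin N, (q (i : ℕ) : ℝ) = ((∑ K ∈ Finset.range (L ^ n), q K : ℚ) : ℝ) := by
        push_cast
        rw [Finset.sum_range]
      rw [this, hq]
    refine ⟨⟨A₀, _, hA₀s, (isSemialgebraicFunOn_ratCast hA₀s 0).congr fun x _ => (hfun x).symm,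
      ?_⟩, rfl, rfl⟩
    rw [show (fun x => W₀.integrand x + ∑ i : Fin N, (E i).integrand x) = fun _ => ((0 : ℚ) : ℝ)
      from funext hfun]
    exact integrableOn_const hA₀vol
  obtain ⟨W, hWd, hWi⟩ := hWex
  have e4 : of W - of W₀ - ∑ i : Fin N, of (E i) ∈ relations :=
    of_sub_of_sub_sum_mem_relations N W W₀ E (by rw [hW₀d, hWd]) (fun i => by rw [hEd, hWd])
      fun x _ => by rw [hWi]
  have e4' : of W₀ ∈ relations := of_mem_relations_of_eqOn_zero W₀ fun x _ => by rw [hW₀i]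
  have e4'' : of W ∈ relations := by
    refine of_mem_relations_of_eqOn_zero W fun x _ => ?_
    rw [hWi]
    show W₀.integrand x + ∑ i : Fin N, (E i).integrand x = 0
    rw [hW₀i, Pi.zero_apply, zero_add]
    simp_rw [hEi]
    have : ∑ i : Fin N, (q (i : ℕ) : ℝ) = ((∑ K ∈ Finset.range (L ^ n), q K : ℚ) : ℝ) := by
      push_cast
      rw [Finset.sum_range]
    rw [this, hq]
    push_cast
    rfl
  have e5 : ∑ i : Fin N, of (E i) ∈ relations := by
    have : ∑ i : Fin N, of (E i) = of W - of W₀ - (of W - of W₀ - ∑ i : Fin N, of (E i)) := by abel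
    rw [this]
    exact relations.sub_mem (relations.sub_mem e4'' e4') e4
  -- assemble
  have : of Z = (of Z - of Z₀ - ∑ i : Fin N, of (P i)) + of Z₀ +
      (∑ i : Fin N, of (P i) - ∑ i : Fin N, of (B i)) -
      (∑ i : Fin N, of (E i) - ∑ i : Fin N, of (B i)) + ∑ i : Fin N, of (E i) := by abel
  rw [this]
  exact relations.add_mem (relations.sub_mem (relations.add_mem (relations.add_mem e1 e1') e2) e3) e5

/-- **Registered sub-goal `zeroSumStep_mem_relations` (line `registered`,
stmt-KontsevichZagierPeriods-3155):** zero-sum rational step functions on translated dyadic grids,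
read as integral representations on `ℝⁿ`, are relations of the KZ calculus (closed form of
`of_mem_relations_of_step`). [cite: KontsevichZagier2001, §1.2 rules (1), (2)] -/
theorem zeroSumStep_mem_relations : ∀ {n j L R : ℕ} (q : ℕ → ℚ),
    ∑ K ∈ Finset.range (L ^ n), q K = 0 → ∀ (Z : KZ.IntegralRep n), Z.domain = Set.univ →
      (∀ x, Z.integrand x = ∑ K ∈ Finset.range (L ^ n),
        (q K : ℝ) * (hoCube j (digits n L K)).indicator 1 (x + fun _ : Fin n => (R : ℝ))) →
      KZ.of Z ∈ KZ.relations :=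
  fun q hq Z hZd hZi => of_mem_relations_of_step q hq Z hZd hZi

end Summit.KontsevichZagierPeriods.StandardParts
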